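import Mathlib.Analysis.Calculus.FDeriv.Basic
import Mathlib.Analysis.Normed.Module.FiniteDimension
import Mathlib.LinearAlgebra.Matrix.ToLin
import Mathlib.LinearAlgebra.Determinant
import Mathlib.Topology.Algebra.Module.FiniteDimension
import HarnessLib

/-!
# KontsevichZagierPeriods / DefinableMoves — `CovTransfer`, bookkeeping II: the Fréchet
# derivative within a set, in coordinates

Helper file for item stmt-KontsevichZagierPeriods-4093 (`CovTransfer`) of route
`DefinableMoves`: the side condition `HasFDerivWithinAt Φ (Φ' x) σ x` of the change-of-variables
move is an `ε`–`δ` statement in the sup metric of `ℝⁿ` whose atoms are polynomial inequalities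
in the coordinates of the points and the entries of the matrix of `Φ' x`
(`hasFDerivWithinAt_iff_coord`), and the determinant of `Φ' x` is the determinant polynomial of
those entries. Pure Mathlib analysis / linear algebra; nothing here is specific to periods.
-/

noncomputable section

open Set Filter Topology

namespace Summit.KontsevichZagierPeriods.DefinableMoves.CovTransferAux

variable {n : ℕ}

/-- In the sup norm of `ℝⁿ`, `‖w‖ ≤ c‖u‖` (with `0 ≤ c`) iff every coordinate of `w` is bounded
by `c` times some coordinate of `u` in absolute value. [folklore] -/
theorem pi_norm_le_mul_norm_iff {c : ℝ} (hc : 0 ≤ c) (w u : Fin n → ℝ) :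
    ‖w‖ ≤ c * ‖u‖ ↔ ∀ i, ∃ j, |w i| ≤ c * |u j| := by
  have hex : ∀ _i : Fin n, ∃ j, ‖u‖ ≤ ‖u j‖ := by
    intro i
    by_contra h
    simp only [not_exists, not_le] at h
    rcases (norm_nonneg u).eq_or_lt with h0 | hpos
    · exact (lt_irrefl _) ((h i).trans_le (h0 ▸ norm_nonneg (u i)))
    · exact (lt_irrefl _) ((pi_norm_lt_iff hpos).2 h)
  constructor
  · intro h i
    obtain ⟨j, hj⟩ := hex i
    refine ⟨j, ?_⟩
    calc |w i| = ‖w i‖ := (Real.norm_eq_abs _).symm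
      _ ≤ ‖w‖ := norm_le_pi_norm w i
      _ ≤ c * ‖u‖ := h
      _ ≤ c * ‖u j‖ := mul_le_mul_of_nonneg_left hj hc
      _ = c * |u j| := by rw [Real.norm_eq_abs]
  · intro h
    refine (pi_norm_le_iff_of_nonneg (by positivity)).2 fun i => ?_
    obtain ⟨j, hj⟩ := h i
    calc ‖w i‖ = |w i| := Real.norm_eq_abs _
      _ ≤ c * |u j| := hj
      _ = c * ‖u j‖ := by rw [Real.norm_eq_abs]
      _ ≤ c * ‖u‖ := mul_le_mul_of_nonneg_left (norm_le_pi_norm u j) hc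

/-- **The derivative within a set, in coordinates.** For maps `ℝⁿ → ℝⁿ`,
`HasFDerivWithinAt F L s x` iff for every `c > 0` there is `δ > 0` such that for all `x₁ ∈ s`
with all `|x₁ i - x i| < δ`, every coordinate of `F x₁ - F x - L (x₁ - x)` is at most `c` times
some `|x₁ j - x j|` (little-`o` in the sup metric). [folklore] -/
theorem hasFDerivWithinAt_iff_coord {F : (Fin n → ℝ) → (Fin n → ℝ)}
    {L : (Fin n → ℝ) →L[ℝ] (Fin n → ℝ)} {s : Set (Fin n → ℝ)} {x : Fin n → ℝ} :
    HasFDerivWithinAt F L s x ↔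
      ∀ c : ℝ, 0 < c → ∃ δ : ℝ, 0 < δ ∧ ∀ x₁ ∈ s, (∀ i, |x₁ i - x i| < δ) →
        ∀ i, ∃ j, |(F x₁ - F x - L (x₁ - x)) i| ≤ c * |x₁ j - x j| := by
  rw [hasFDerivWithinAt_iff_isLittleO, Asymptotics.isLittleO_iff]
  constructor
  · intro h c hc
    have h' := h hc
    rw [eventually_nhdsWithin_iff, Metric.eventually_nhds_iff] at h'
    obtain ⟨δ, hδ, hh⟩ := h'
    refine ⟨δ, hδ, fun x₁ hx₁ hlt => ?_⟩
    have hdist : dist x₁ x < δ := by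
      rw [dist_pi_lt_iff hδ]
      intro i
      rw [Real.dist_eq]
      exact hlt i
    exact (pi_norm_le_mul_norm_iff hc.le _ _).1 (hh hdist hx₁)
  · intro h c hc
    rw [eventually_nhdsWithin_iff, Metric.eventually_nhds_iff]
    obtain ⟨δ, hδ, hh⟩ := h c hc
    refine ⟨δ, hδ, fun x₁ hdist hx₁ => (pi_norm_le_mul_norm_iff hc.le _ _).2 (hh x₁ hx₁ fun i => ?_)⟩
    rw [dist_pi_lt_iff hδ] at hdist
    have := hdist i
    rwa [Real.dist_eq] at this

/-- `|u| ≤ c|w|` iff `u² ≤ c²w²`, for `0 ≤ c`. [folklore] -/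
theorem abs_le_mul_abs_iff_sq {c : ℝ} (hc : 0 ≤ c) (u w : ℝ) :
    |u| ≤ c * |w| ↔ u ^ 2 ≤ c ^ 2 * w ^ 2 := by
  rw [← abs_of_nonneg hc, ← abs_mul, ← sq_le_sq, abs_of_nonneg hc, mul_pow]

/-- A continuous linear endomorphism of `ℝⁿ` acts through its standard matrix:
`(L v) i = ∑ k, M i k * v k` with `M = LinearMap.toMatrix' L`. [folklore] -/
theorem clm_apply_eq_sum_toMatrix' (L : (Fin n → ℝ) →L[ℝ] (Fin n → ℝ)) (v : Fin n → ℝ)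
    (i : Fin n) :
    L v i = ∑ k, LinearMap.toMatrix' (L : (Fin n → ℝ) →ₗ[ℝ] (Fin n → ℝ)) i k * v k := by
  have h2 : L v = Matrix.toLin' (LinearMap.toMatrix' (L : (Fin n → ℝ) →ₗ[ℝ] (Fin n → ℝ))) v := by
    rw [Matrix.toLin'_toMatrix']
    rfl
  rw [h2, Matrix.toLin'_apply]
  rfl

/-- The determinant of a continuous linear endomorphism of `ℝⁿ` is the determinant of its
standard matrix. [folklore] -/
theorem clm_det_eq_det_toMatrix' (L : (Fin n → ℝ) →L[ℝ] (Fin n → ℝ)) :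
    L.det = (LinearMap.toMatrix' (L : (Fin n → ℝ) →ₗ[ℝ] (Fin n → ℝ))).det := by
  rw [LinearMap.det_toMatrix']

/-- The continuous linear endomorphism of `ℝⁿ` with standard matrix `M` acts by
`v ↦ (∑ k, M i k * v k)_i`. [folklore] -/
theorem toContinuousLinearMap_toLin'_apply (M : Matrix (Fin n) (Fin n) ℝ) (v : Fin n → ℝ)
    (i : Fin n) :
    LinearMap.toContinuousLinearMap (Matrix.toLin' M) v i = ∑ k, M i k * v k := by
  simp only [LinearMap.coe_toContinuousLinearMap', Matrix.toLin'_apply]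
  rfl

/-- The continuous linear endomorphism of `ℝⁿ` with standard matrix `M` has determinant
`det M`. [folklore] -/
theorem toContinuousLinearMap_toLin'_det (M : Matrix (Fin n) (Fin n) ℝ) :
    (LinearMap.toContinuousLinearMap (Matrix.toLin' M)).det = M.det := by
  simp only [ContinuousLinearMap.det, LinearMap.coe_toContinuousLinearMap,
    LinearMap.det_toLin']

end Summit.KontsevichZagierPeriods.DefinableMoves.CovTransferAux

end
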